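import Summits.AtomisticToContinuum.BoseEinsteinCondensation.Theses.BECInfraredBound
import Summits.AtomisticToContinuum.BoseEinsteinCondensation.Theorems.BECGroundStateSOSIRModeCounting
import Summits.AtomisticToContinuum.BoseEinsteinCondensation.Theorems.BECThomsonPrincipleGDTransferWindowLaw

/-!
# Crux `BecWindowCount` (stmt-AtomisticToContinuum-9015) — ideator-2 sketch (round 1)

Idea `in-tree-counts-homogeneous`: both lattice counts the crux needs are ALREADY PROVED in tree in
HOMOGENEOUS form — `ModeCounting.sum_inv_norm_latticeShell_le_sq` (`Σ_{0<‖k‖∞≤M} 1/‖k‖∞ ≤ 26M²`,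
Theorems/BECGroundStateSOSIRModeCounting) and `GDTransfer.DysonDressedWitness.card_latticeShell_le`
(`#((box M) ∖ 0) ≤ 26M³`, Theorems/BECThomsonPrincipleGDTransferWindowLaw). With `M = ⌊K√ρL⌋₊ ≤ K√ρL`
and `(√ρL)³ = √ρ·N` exactly, the window mass is `≤ 26C(K³+K²)√ρ·N` for EVERY `N` — no `N^{2/3}` term,
no eventual-in-`N` absorption. The only new Lean is the currency adapter `window_tsum_le_sum`.
-/

noncomputable section

open Filter
open scoped ENNReal BigOperators

namespace Summit.AtomisticToContinuum.BoseEinsteinCondensation.Cruxes.BecWindowCount.IdeaSketch2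

open Literature.MathematicalPhysics.QuantumManyBody.BoseGas
open Summit.AtomisticToContinuum.BoseEinsteinCondensation.Theorems.ModeCounting
  (mem_latticeBox card_latticeBox zero_mem_latticeBox mem_latticeBox_floor_of_norm_le
    sum_inv_norm_latticeShell_le_sq)
open Summit.AtomisticToContinuum.BoseEinsteinCondensation.Cruxes.GDTransfer.DysonDressedWitness
  (card_latticeShell_le)

local notation "box[" M "]" =>
  (Fintype.piFinset fun _ : Fin 3 => Finset.Icc (-((M : ℕ) : ℤ)) ((M : ℕ) : ℤ) :
    Finset (Fin 3 → ℤ))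

local notation "ν[" k "]" => ‖(fun i : Fin 3 => (((k : Fin 3 → ℤ) i : ℤ) : ℝ))‖

/-- FIRST LEMMA (the currency adapter): an `ℝ≥0∞` tsum over the crux's window subtype
`{k ≠ 0 ∧ ‖k‖∞ ≤ R}` is dominated by the `Finset` sum over the punctured cube of radius `⌊R⌋₊`
(the window embeds into it by `mem_latticeBox_floor_of_norm_le`; nonnegativity does the rest). -/
theorem window_tsum_le_sum (R : ℝ) (f : (Fin 3 → ℤ) → ℝ≥0∞) :
    ∑' k : {k : Fin 3 → ℤ // k ≠ 0 ∧ ‖(fun j => (k j : ℝ))‖ ≤ R}, f k.1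
      ≤ ∑ k ∈ (box[⌊R⌋₊]).erase 0, f k := by
  classical
  set S : Set (Fin 3 → ℤ) := {k | k ≠ 0 ∧ ‖(fun j => (k j : ℝ))‖ ≤ R} with hS
  set F : Finset (Fin 3 → ℤ) := (box[⌊R⌋₊]).erase 0 with hF
  have hSF : S ⊆ (F : Set (Fin 3 → ℤ)) := by
    rintro k ⟨hk0, hkR⟩
    exact Finset.mem_coe.2 (Finset.mem_erase.2 ⟨hk0, mem_latticeBox_floor_of_norm_le hkR⟩)
  calc ∑' k : {k : Fin 3 → ℤ // k ≠ 0 ∧ ‖(fun j => (k j : ℝ))‖ ≤ R}, f k.1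
      = ∑' k, S.indicator f k := tsum_subtype S f
    _ ≤ ∑' k, (F : Set (Fin 3 → ℤ)).indicator f k :=
        ENNReal.tsum_le_tsum fun k =>
          Set.indicator_le_indicator_of_subset hSF (fun _ => zero_le) k
    _ = ∑ k ∈ F, f k := (sum_eq_tsum_indicator f F).symm

/-- HOMOGENEOUS WINDOW PROFILE BOUND (replaces birth's `stub_windowLatticeSum` AND makes its
`stub_smallDensityAbsorption` unnecessary): for `R, s ≥ 0`,
`Σ'_{k ≠ 0, ‖k‖∞ ≤ R} (1 + s/‖k‖∞) ≤ 26R³ + 26·s·R²` — both counts from the tree, `⌊R⌋₊ ≤ R`. -/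
theorem windowProfile_sum_le {R s : ℝ} (hR : 0 ≤ R) (hs : 0 ≤ s) :
    ∑' k : {k : Fin 3 → ℤ // k ≠ 0 ∧ ‖(fun j => (k j : ℝ))‖ ≤ R},
        ENNReal.ofReal (1 + s / ‖(fun j => (k.1 j : ℝ))‖)
      ≤ ENNReal.ofReal (26 * R ^ 3 + 26 * s * R ^ 2) := by
  classical
  set M : ℕ := ⌊R⌋₊ with hM
  have hMR : (M : ℝ) ≤ R := Nat.floor_le hR
  refine (window_tsum_le_sum R (fun k => ENNReal.ofReal (1 + s / ν[k]))).trans ?_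
  rw [← ENNReal.ofReal_sum_of_nonneg (fun k _ => by positivity)]
  refine ENNReal.ofReal_le_ofReal ?_
  calc ∑ k ∈ (box[M]).erase 0, (1 + s / ν[k])
      = ((((box[M]).erase 0).card : ℕ) : ℝ) + s * ∑ k ∈ (box[M]).erase 0, 1 / ν[k] := by
        rw [Finset.sum_add_distrib, Finset.sum_const, nsmul_eq_mul, mul_one, Finset.mul_sum]
        congr 1
        exact Finset.sum_congr rfl fun k _ => by ring
    _ ≤ 26 * (M : ℝ) ^ 3 + s * (26 * (M : ℝ) ^ 2) := by
        gcongr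
        · exact card_latticeShell_le M
        · exact sum_inv_norm_latticeShell_le_sq M
    _ ≤ 26 * R ^ 3 + s * (26 * R ^ 2) := by gcongr
    _ = 26 * R ^ 3 + 26 * s * R ^ 2 := by ring

/-- THERMODYNAMIC SCALING, EXACT: with `L = sideLength ρ N = (N/ρ)^{1/3}`, `(√ρ·L)³ = √ρ·N`, so the
homogeneous window bound at `R = K√ρL`, `s = √ρL` is the pure multiple `26(K³+K²)√ρ·N` of `N`. -/
theorem window_scaling {ρ : ℝ} (hρ : 0 < ρ) (K : ℝ) (N : ℕ) :
    26 * (K * Real.sqrt ρ * sideLength ρ N) ^ 3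
        + 26 * (Real.sqrt ρ * sideLength ρ N) * (K * Real.sqrt ρ * sideLength ρ N) ^ 2
      = 26 * (K ^ 3 + K ^ 2) * Real.sqrt ρ * N := by
  have hL3 : sideLength ρ N ^ 3 = N / ρ := sideLength_pow_three hρ N
  have hs3 : Real.sqrt ρ ^ 3 = ρ * Real.sqrt ρ := by
    rw [pow_succ, Real.sq_sqrt hρ.le]
  have h3 : (Real.sqrt ρ * sideLength ρ N) ^ 3 = Real.sqrt ρ * N := by
    rw [mul_pow, hs3, hL3]
    field_simp
  calc 26 * (K * Real.sqrt ρ * sideLength ρ N) ^ 3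
        + 26 * (Real.sqrt ρ * sideLength ρ N) * (K * Real.sqrt ρ * sideLength ρ N) ^ 2
      = 26 * (K ^ 3 + K ^ 2) * (Real.sqrt ρ * sideLength ρ N) ^ 3 := by ring
    _ = 26 * (K ^ 3 + K ^ 2) * Real.sqrt ρ * N := by rw [h3]; ring

/-- THE CRUX BY NAME along this line (de-risking run of the idea; `ρ₀ := min ρ₀^IR (η/A)²`,
`A = 26(K³+K²)C`; the SAME `δ` and the SAME eventuality as the infrared hypothesis — nothing is
absorbed "eventually in `N`"). -/
theorem becWindowCount_via_inTreeCounts :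
    Summit.AtomisticToContinuum.BoseEinsteinCondensation.Theses.BECInfraredBound.BecWindowCount := by
  intro v _hv hIR ε hε hε4 K hK η hη
  obtain ⟨ρ₁, hρ₁, C, hC, H1⟩ := hIR ε hε hε4 K hK
  set A : ℝ := 26 * (K ^ 3 + K ^ 2) * C with hA
  have hA0 : 0 < A := by positivity
  set ρ₂ : ℝ := (η / A) ^ 2 with hρ₂
  have hρ₂0 : 0 < ρ₂ := by positivity
  refine ⟨min ρ₁ ρ₂, lt_min hρ₁ hρ₂0, fun ρ hρ hρlt => ?_⟩
  have hρ1 : ρ < ρ₁ := lt_of_lt_of_le hρlt (min_le_left _ _)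
  have hρ2 : ρ < ρ₂ := lt_of_lt_of_le hρlt (min_le_right _ _)
  have hsq : A * Real.sqrt ρ ≤ η := by
    have h1 : Real.sqrt ρ < η / A := by
      calc Real.sqrt ρ < Real.sqrt ρ₂ := Real.sqrt_lt_sqrt hρ.le hρ2
        _ = η / A := by rw [hρ₂, Real.sqrt_sq (by positivity)]
    rw [lt_div_iff₀ hA0] at h1
    linarith
  filter_upwards [H1 ρ hρ hρ1] with N hN
  obtain ⟨δ, hδ, HΨ⟩ := hN
  refine ⟨δ, hδ, fun Ψ hΨ => ?_⟩
  have hL0 : 0 ≤ sideLength ρ N := sideLength_nonneg hρ.le N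
  have hs0 : 0 ≤ Real.sqrt ρ * sideLength ρ N := by positivity
  have hR0 : 0 ≤ K * Real.sqrt ρ * sideLength ρ N := by positivity
  have hpt := fun k : {k : Fin 3 → ℤ // k ≠ 0 ∧ ‖(fun j => (k j : ℝ))‖ ≤
      K * Real.sqrt ρ * sideLength ρ N} => HΨ Ψ hΨ k.1 k.2.1 k.2.2
  refine (ENNReal.tsum_le_tsum hpt).trans ?_
  have hmul : ∀ k : {k : Fin 3 → ℤ // k ≠ 0 ∧ ‖(fun j => (k j : ℝ))‖ ≤
      K * Real.sqrt ρ * sideLength ρ N},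
      ENNReal.ofReal (C * (1 + Real.sqrt ρ * sideLength ρ N / ‖(fun j => (k.1 j : ℝ))‖))
        = ENNReal.ofReal C *
          ENNReal.ofReal (1 + Real.sqrt ρ * sideLength ρ N / ‖(fun j => (k.1 j : ℝ))‖) :=
    fun k => ENNReal.ofReal_mul hC.le
  rw [tsum_congr hmul, ENNReal.tsum_mul_left]
  calc ENNReal.ofReal C * ∑' k : {k : Fin 3 → ℤ // k ≠ 0 ∧ ‖(fun j => (k j : ℝ))‖ ≤
          K * Real.sqrt ρ * sideLength ρ N},
          ENNReal.ofReal (1 + Real.sqrt ρ * sideLength ρ N / ‖(fun j => (k.1 j : ℝ))‖)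
      ≤ ENNReal.ofReal C * ENNReal.ofReal (26 * (K * Real.sqrt ρ * sideLength ρ N) ^ 3
          + 26 * (Real.sqrt ρ * sideLength ρ N) * (K * Real.sqrt ρ * sideLength ρ N) ^ 2) := by
        gcongr
        exact windowProfile_sum_le hR0 hs0
    _ = ENNReal.ofReal (C * (26 * (K ^ 3 + K ^ 2) * Real.sqrt ρ * N)) := by
        rw [← ENNReal.ofReal_mul hC.le, window_scaling hρ K N]
    _ ≤ ENNReal.ofReal (η * N) := by
        refine ENNReal.ofReal_le_ofReal ?_
        calc C * (26 * (K ^ 3 + K ^ 2) * Real.sqrt ρ * N) = (A * Real.sqrt ρ) * N := by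
              rw [hA]; ring
          _ ≤ η * N := mul_le_mul_of_nonneg_right hsq (Nat.cast_nonneg N)

end Summit.AtomisticToContinuum.BoseEinsteinCondensation.Cruxes.BecWindowCount.IdeaSketch2
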